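import Mathlib
import Literature.NumberTheory.Sieve.BatemanHornProofs
import Literature.NumberTheory.Sieve.ParityWave0BunyakovskyProofs

/-!
# Crux `PolyMobiusTail` (stmt-Parity-0870), line `Sketch` (natural form): stub `stub_eventually_two_le`

For a Bateman–Horn system `f = (f₁,…,f_k)` every `fᵢ` has positive degree
(`Literature.NumberTheory.Sieve.IsBatemanHornSystem.natDegree_pos`: a constant member would be a
fixed prime divisor) and positive leading coefficient, so `fᵢ(n) → +∞` along `ℕ`
(`Literature.NumberTheory.Sieve.tendsto_eval_natCast_atTop`) and all values `fᵢ(n).toNat` are `≥ 2`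
from some point on.  This is the registered stub `stub_eventually_two_le` of the lead's skeleton
`Cruxes/PolyMobiusTail/Lines/Sketch.lean` (it feeds the pointwise S-expansion, which needs that no
value equals `1`).
-/

open Filter Polynomial

namespace Summit.Parity.BatemanHorn.Theorems.PolyMobiusTail.NaturalForm

/-- **Stub `stub_eventually_two_le`.** For a Bateman–Horn system `f`, there is `N` such that
`2 ≤ (fᵢ(n)).toNat` for every `n ≥ N` and every `i`. [folklore] -/
theorem stub_eventually_two_le : ∀ (k : ℕ) (f : Fin k → ℤ[X]),
    Literature.NumberTheory.Sieve.IsBatemanHornSystem f →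
      ∃ N : ℕ, ∀ n : ℕ, N ≤ n → ∀ i, 2 ≤ ((f i).eval (n : ℤ)).toNat := by
  intro k f hf
  have h : ∀ᶠ n : ℕ in atTop, ∀ i, (2 : ℤ) ≤ (f i).eval (n : ℤ) :=
    Filter.eventually_all.mpr fun i =>
      (Literature.NumberTheory.Sieve.tendsto_eval_natCast_atTop
        (Nat.succ_le_of_lt (hf.natDegree_pos i)) (hf.leadingCoeff_pos i)).eventually_ge_atTop 2
  obtain ⟨N, hN⟩ := Filter.eventually_atTop.mp h
  refine ⟨N, fun n hn i => ?_⟩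
  have h2 := hN n hn i
  omega

end Summit.Parity.BatemanHorn.Theorems.PolyMobiusTail.NaturalForm
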